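import Summits.NavierStokesRegularity.FluidComputer.PalasekTowerFaceLayerAtEnvelope
import Summits.NavierStokesRegularity.NavierStokesRegularity.Theses.PalasekTowerBreakdown

/-!
# BC3 birth skeleton **v2** (FIVE-FACE cut, all levels `k ≥ 2`) for crux `HeredityFromTwoT`
# (stmt-NavierStokesRegularity-20305) of route `PalasekTowerBreakdown` (rev 19, `TowerRates.tuned`)

Planner `ns-blowup-plan` (g23), 2026-08-27. Supersedes v1 (`BIRTH-20305-HeredityFromTwoT-v1.lean`, sha16 469797912a86b3eb — WRITTEN to `Cruxes/HeredityFromTwoT/Lines/birth.lean`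
51f75a104c4a but skeleton audit `FAIL skeleton.extra-hypothesis`: its curried `HeredityFromTwoT_of` carried `∀ k ≥ 2` binders, which have no
registered constant head; v2 keeps EXACTLY ONE theorem concluding the route decl — the hypothesis-free composition — DIRECTOR-NS #48 (4)).
Stated over the TREE's R-generic face layer (fc-prover-2 g9, p527094 + part II `…FaceLayerAtEnvelope`,
`heredityFromGAt_of_faces` / `readoutFloorsGAt_of_floors`) — the tuned twin of the wide v4 `Cruxes/HeredityFromTwo/Lines/birth.lean`.

* `stub_no_premature_breakdown_from2 : ∀ k ≥ 2, NoPrematureBreakdownGAt tuned k` (HARDEST, level-uniform a-priori control);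
* `stub_window_ceiling_from2 : ∀ k ≥ 2, WindowCeilingGAt tuned k`;
* `stub_speed_floor_from2 / stub_strain_floor_from2 / stub_core_floor_from2 : ∀ k ≥ 2, …FloorGAt tuned k` (the generic
  self-similar step: in the child's units every level `k ≥ 2` is the same episode up to the super-exponentially shrinking
  corrections `σ_k = N_k^{b−1}`, `Re_k = N_k^{β−2}` — cf. `PalasekTowerFaceLacunarityLaws`);
* `HeredityFromTwoT_of` — kernel-checked composition concluding
  `Summit.NavierStokesRegularity.NavierStokesRegularity.Theses.PalasekTowerBreakdown.HeredityFromTwoT` BY NAME (the ONLY theorem with that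
  conclusion; the curried five-face implication is `heredityFromGAt_tuned_two_of_faces`, concluding the unfolded `HeredityFromGAt TowerRates.tuned 2`).

Kill currency (K198 R1): one registered tuned design at ONE level `k ≥ 2` whose quiet free run misses a level-(k+1) floor.
Endowment caveat (refuter4 K193 R1): level-uniformity needs the child's circulation in floor units `C_k` with `C_k·B_k ≥ 19.88`
at every level — the single-parent Kelvin law `C_{k+1} ≤ C_k·σ_k^{−(β−2)}` fails the binding beyond k ≈ 19 at tuned with C₀ = 26, so the cascade
needs folding multiplicity `m_k = σ_k^{β−2}` per level = evasion (1) of the Kelvin-ceiling binding sentence (`PalasekTowerKelvinCeiling`). LABEL: E–C typing skeleton; sorries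
ONLY inside `stub_*`. WHAT THIS IS NOT: not NS evidence; nothing inhabited.
-/

noncomputable section

namespace Summit.NavierStokesRegularity.FluidComputer.PalasekTowerClayBridge.BirthHeredityFromTwoTv2

open Summit.NavierStokesRegularity.FluidComputer
open Summit.NavierStokesRegularity.FluidComputer.PalasekTowerClayBridge

/-- STUB 1 (hardest): no premature breakdown on window `k`, every `k ≥ 2`, at the tuned rates. -/
theorem stub_no_premature_breakdown_from2 : ∀ k : ℕ, 2 ≤ k → NoPrematureBreakdownGAt TowerRates.tuned k := by
  sorry

/-- STUB 2: the window-`k` speed ceiling `(5/3)·Y_{k+1}`, every `k ≥ 2`. -/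
theorem stub_window_ceiling_from2 : ∀ k : ℕ, 2 ≤ k → WindowCeilingGAt TowerRates.tuned k := by
  sorry

/-- STUB 3: speed readout at `τ_{k+1}`, every `k ≥ 2`. -/
theorem stub_speed_floor_from2 : ∀ k : ℕ, 2 ≤ k → SpeedFloorGAt TowerRates.tuned k := by
  sorry

/-- STUB 4: gradient readout at `τ_{k+1}`, every `k ≥ 2`. -/
theorem stub_strain_floor_from2 : ∀ k : ℕ, 2 ≤ k → StrainFloorGAt TowerRates.tuned k := by
  sorry

/-- STUB 5: core-loop circulation readout at `τ_{k+1}`, every `k ≥ 2`. -/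
theorem stub_core_floor_from2 : ∀ k : ℕ, 2 ≤ k → CoreFloorGAt TowerRates.tuned k := by
  sorry

/-- The curried implication (kernel-checked, no `sorry`): the five tuned faces at every level `k ≥ 2` ⇒ the crux's UNFOLDED tree
statement `HeredityFromGAt TowerRates.tuned 2`, via fc-prover-2's R-generic `heredityFromGAt_of_faces` + `readoutFloorsGAt_of_floors`
(face layer parts I/II). Not a skeleton candidate (does not conclude the route decl by name; its `∀ k ≥ 2` binders have no constant
head, so the audit would not admit them as binders of a candidate — hence the hypothesis-free composition below). -/
theorem heredityFromGAt_tuned_two_of_faces :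
    (∀ k : ℕ, 2 ≤ k → NoPrematureBreakdownGAt TowerRates.tuned k) →
    (∀ k : ℕ, 2 ≤ k → WindowCeilingGAt TowerRates.tuned k) →
    (∀ k : ℕ, 2 ≤ k → SpeedFloorGAt TowerRates.tuned k) →
    (∀ k : ℕ, 2 ≤ k → StrainFloorGAt TowerRates.tuned k) →
    (∀ k : ℕ, 2 ≤ k → CoreFloorGAt TowerRates.tuned k) →
    HeredityFromGAt TowerRates.tuned 2 :=
  fun hN hW h₁ h₂ h₃ =>
    heredityFromGAt_of_faces hN hW (fun k hk => readoutFloorsGAt_of_floors (h₁ k hk) (h₂ k hk) (h₃ k hk))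

/-- **The skeleton (the ONLY theorem of this file concluding the route's crux `HeredityFromTwoT` BY NAME)**: the crux assembled
from its five declared stubs (sorries live only in the five `stub_*`; decoration, not closure evidence). -/
theorem HeredityFromTwoT_of :
    Summit.NavierStokesRegularity.NavierStokesRegularity.Theses.PalasekTowerBreakdown.HeredityFromTwoT :=
  heredityFromGAt_tuned_two_of_faces stub_no_premature_breakdown_from2 stub_window_ceiling_from2 stub_speed_floor_from2
    stub_strain_floor_from2 stub_core_floor_from2

/-- Converse bookkeeping: the route decl gives back each face at every `k ≥ 2` (no stub is decoration). -/
theorem faces_of_HeredityFromTwoT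
    (h : Summit.NavierStokesRegularity.NavierStokesRegularity.Theses.PalasekTowerBreakdown.HeredityFromTwoT)
    (k : ℕ) (hk : 2 ≤ k) :
    NoPrematureBreakdownGAt TowerRates.tuned k ∧ WindowCeilingGAt TowerRates.tuned k ∧
      SpeedFloorGAt TowerRates.tuned k ∧ StrainFloorGAt TowerRates.tuned k ∧ CoreFloorGAt TowerRates.tuned k :=
  (heredityAtGAt_iff_noPrematureBreakdown_windowCeiling_floors3 k).1 (fun S hP hR hQ s => h S hP hR hQ k hk s)

end Summit.NavierStokesRegularity.FluidComputer.PalasekTowerClayBridge.BirthHeredityFromTwoTv2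

end
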